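import Mathlib
import Summits.ValiantsHypothesis.ValiantsHypothesis.Theorems.NewtonUnitEquationsDissociatedUniformTotalsLaw
import Literature.Computability.AlgebraicComplexity.NewtonPolygonTauProductBounds
import HarnessLib

/-!
# Crux `NewtonUnitEquations.DissociatedUniform` (stmt-ValiantsHypothesis-5905): totals law — winners sit near the top (the share bounds)

Companion of `…DissociatedUniformTotalsLaw`.  Fix a weight (direction) `w`.  The fibre `P_r = {a x + b (r - x)}` has the support
value `fibreSup w a b r = max_x ⟨w, a x + b (r - x)⟩`; every fibre uses every `x` and every `y` exactly once, so all fibres have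
the same coordinate SUM `∑ a + ∑ b` (`sum_fibre_eq`) and therefore all support values lie in ONE band
`[⟨w, ∑a + ∑b⟩ / |G|, max_r fibreSup]` of width `bandWidth w a b` (`fibreSup_sub_fibreSup_le_bandWidth`) — the "equal centroids"
rigidity of memo NOTES-d1g3 §2 L5/L6.  A class-`s` vertex exposed by `w` lying in the blob of fibre `r` at position `c z`
(`s = r + z`) makes `(r, z)` a WINNING pair (`Wins`: `fibreSup r' + ⟨w, c (r + z - r')⟩ ≤ fibreSup r + ⟨w, c z⟩` for all `r'`;
`wins_of_isStrictTop`).  Two one-line consequences are the share bounds behind the separated ("third curve dominant") regime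
(memo NOTES-t1 D7):
* `Wins.pos_near_top`   — a winning POSITION is within `bandWidth` of the top of `⟨w, c ·⟩` (so if the projections of `C` are
  more than `bandWidth` apart, only the top position wins: multiplicity ≤ 1 at that direction);
* `Wins.fibre_near_top` — a winning FIBRE is within `width_C(w) = max ⟨w,c⟩ - min ⟨w,c⟩` of the top fibre.
Pure bookkeeping over the group plus `IsStrictTop` of the tree's planar calculus; nothing about the law itself is claimed.
[folklore]
-/

set_option linter.dupNamespace false -- `ValiantsHypothesis.ValiantsHypothesis` (summit = problem) in every name

open scoped BigOperators
open Matrix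

namespace Summit.ValiantsHypothesis.ValiantsHypothesis.Theorems.NewtonUnitEquationsDissociatedUniform

namespace TotalsLaw

variable {G : Type*} [AddCommGroup G] [Fintype G]

/-- `Finset.univ` of a (finite) additive group is nonempty. -/
theorem univ_nonempty_group : (Finset.univ : Finset G).Nonempty := ⟨0, Finset.mem_univ _⟩

/-- The support value of the fibre `P_r` in direction `w`: `max_x ⟨w, a x + b (r - x)⟩`. -/
noncomputable def fibreSup (w : Fin 2 → ℝ) (a b : G → (Fin 2 → ℝ)) (r : G) : ℝ :=
  Finset.univ.sup' univ_nonempty_group fun x : G => w ⬝ᵥ (a x + b (r - x))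

/-- The top position value `max_z ⟨w, c z⟩`. -/
noncomputable def topVal (w : Fin 2 → ℝ) (c : G → (Fin 2 → ℝ)) : ℝ :=
  Finset.univ.sup' univ_nonempty_group fun z : G => w ⬝ᵥ c z

/-- The bottom position value `min_z ⟨w, c z⟩`. -/
noncomputable def botVal (w : Fin 2 → ℝ) (c : G → (Fin 2 → ℝ)) : ℝ :=
  Finset.univ.inf' univ_nonempty_group fun z : G => w ⬝ᵥ c z

/-- The width of the common band of fibre support values: `max_r fibreSup r - ⟨w, ∑ a + ∑ b⟩ / |G|` (top of `A + B` minus the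
common fibre mean). -/
noncomputable def bandWidth (w : Fin 2 → ℝ) (a b : G → (Fin 2 → ℝ)) : ℝ :=
  (Finset.univ.sup' univ_nonempty_group fun r : G => fibreSup w a b r) - w ⬝ᵥ (∑ x, a x + ∑ y, b y) / Fintype.card G

/-- Every fibre point is below the fibre's support value. [folklore] -/
theorem le_fibreSup (w : Fin 2 → ℝ) (a b : G → (Fin 2 → ℝ)) (r x : G) : w ⬝ᵥ (a x + b (r - x)) ≤ fibreSup w a b r :=
  Finset.le_sup' (fun x : G => w ⬝ᵥ (a x + b (r - x))) (Finset.mem_univ x)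

/-- The support value is attained. [folklore] -/
theorem exists_eq_fibreSup (w : Fin 2 → ℝ) (a b : G → (Fin 2 → ℝ)) (r : G) : ∃ x, w ⬝ᵥ (a x + b (r - x)) = fibreSup w a b r := by
  obtain ⟨x, _, hx⟩ := Finset.exists_mem_eq_sup' univ_nonempty_group fun x : G => w ⬝ᵥ (a x + b (r - x))
  exact ⟨x, hx.symm⟩

/-- Every position value is between `botVal` and `topVal`. [folklore] -/
theorem botVal_le (w : Fin 2 → ℝ) (c : G → (Fin 2 → ℝ)) (z : G) : botVal w c ≤ w ⬝ᵥ c z :=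
  Finset.inf'_le (fun z : G => w ⬝ᵥ c z) (Finset.mem_univ z)

/-- Every position value is between `botVal` and `topVal`. [folklore] -/
theorem le_topVal (w : Fin 2 → ℝ) (c : G → (Fin 2 → ℝ)) (z : G) : w ⬝ᵥ c z ≤ topVal w c :=
  Finset.le_sup' (fun z : G => w ⬝ᵥ c z) (Finset.mem_univ z)

/-- **Equal centroids.**  Every fibre has the same coordinate sum `∑ a + ∑ b`. [folklore] -/
theorem sum_fibre_eq (a b : G → (Fin 2 → ℝ)) (r : G) : ∑ x, (a x + b (r - x)) = ∑ x, a x + ∑ y, b y := by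
  have h : ∑ x, b (r - x) = ∑ y, b y := Equiv.sum_comp (Equiv.subLeft r) b
  rw [Finset.sum_add_distrib, h]

/-- The fibre support value is at least the common fibre mean: `|G| · fibreSup r ≥ ⟨w, ∑ a + ∑ b⟩`. [folklore] -/
theorem sum_le_card_mul_fibreSup (w : Fin 2 → ℝ) (a b : G → (Fin 2 → ℝ)) (r : G) :
    w ⬝ᵥ (∑ x, a x + ∑ y, b y) ≤ Fintype.card G * fibreSup w a b r := by
  rw [← sum_fibre_eq a b r, dotProduct_sum]
  calc ∑ x, w ⬝ᵥ (a x + b (r - x)) ≤ ∑ _x : G, fibreSup w a b r := Finset.sum_le_sum fun x _ => le_fibreSup w a b r x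
    _ = Fintype.card G * fibreSup w a b r := by rw [Finset.sum_const, Finset.card_univ, nsmul_eq_mul]

/-- **The common band.**  Any two fibre support values differ by at most `bandWidth`. [folklore] -/
theorem fibreSup_sub_fibreSup_le_bandWidth (w : Fin 2 → ℝ) (a b : G → (Fin 2 → ℝ)) (r r' : G) :
    fibreSup w a b r' - fibreSup w a b r ≤ bandWidth w a b := by
  have hpos : (0 : ℝ) < Fintype.card G := by exact_mod_cast Fintype.card_pos
  have htop : fibreSup w a b r' ≤ Finset.univ.sup' univ_nonempty_group fun r : G => fibreSup w a b r :=
    Finset.le_sup' (fun r : G => fibreSup w a b r) (Finset.mem_univ r')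
  have hmean : w ⬝ᵥ (∑ x, a x + ∑ y, b y) / Fintype.card G ≤ fibreSup w a b r := by
    rw [div_le_iff₀ hpos, mul_comm]
    exact sum_le_card_mul_fibreSup w a b r
  unfold bandWidth
  linarith

/-- `(r, z)` is a WINNING pair in direction `w`: the blob of fibre `r` at position `c z` carries the `w`-maximum of its class
`s = r + z`, i.e. beats every fibre `r'` at the position `c (r + z - r')` it occupies in that class (a predicate, not a named
fact). [folklore] -/
def Wins (w : Fin 2 → ℝ) (a b c : G → (Fin 2 → ℝ)) (r z : G) : Prop :=
  ∀ r', fibreSup w a b r' + w ⬝ᵥ c (r + z - r') ≤ fibreSup w a b r + w ⬝ᵥ c z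

/-- **Exposed words give winning pairs.**  If the word `(x, r - x, z)` of class `s = r + z` is a strict `w`-top of (a finite
model of) the class, then `(r, z)` wins in direction `w`. [folklore] -/
theorem wins_of_isStrictTop (w : Fin 2 → ℝ) (a b c : G → (Fin 2 → ℝ)) (r z x : G) (F : Finset (Fin 2 → ℝ))
    (hF : ∀ x' y' : G, a x' + b y' + c (r + z - x' - y') ∈ F)
    (htop : Literature.Computability.AlgebraicComplexity.KPTT.PlanarMinkowski.IsStrictTop w F (a x + b (r - x) + c z)) :
    Wins w a b c r z := by
  intro r'
  obtain ⟨x', hx'⟩ := exists_eq_fibreSup w a b r'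
  have hmem : a x' + b (r' - x') + c (r + z - x' - (r' - x')) ∈ F := hF x' (r' - x')
  have hle := htop.le hmem
  have hz : r + z - x' - (r' - x') = r + z - r' := by abel
  rw [hz, dotProduct_add w (a x' + b (r' - x')), dotProduct_add w (a x + b (r - x))] at hle
  rw [← hx']
  linarith [le_fibreSup w a b r x]

namespace Wins

variable {w : Fin 2 → ℝ} {a b c : G → (Fin 2 → ℝ)} {r z : G}

/-- **A winning position is near the top of `C`** (memo NOTES-t1 D7(a)): `⟨w, c z'⟩ ≤ ⟨w, c z⟩ + bandWidth` for every `z'`.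
Hence if the projections of `C` in direction `w` are pairwise more than `bandWidth` apart, only the top position can win:
multiplicity ≤ 1 at that direction. [folklore] -/
theorem pos_near_top (h : Wins w a b c r z) (z' : G) : w ⬝ᵥ c z' ≤ w ⬝ᵥ c z + bandWidth w a b := by
  have h1 := h (r + z - z')
  have hz : r + z - (r + z - z') = z' := by abel
  rw [hz] at h1
  linarith [fibreSup_sub_fibreSup_le_bandWidth w a b (r + z - z') r]

/-- The top position value is within `bandWidth` of any winning position. [folklore] -/
theorem topVal_le (h : Wins w a b c r z) : topVal w c ≤ w ⬝ᵥ c z + bandWidth w a b := by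
  obtain ⟨z', _, hz'⟩ := Finset.exists_mem_eq_sup' univ_nonempty_group fun z : G => w ⬝ᵥ c z
  unfold topVal
  rw [hz']
  exact h.pos_near_top z'

/-- **A winning fibre is near the top of `A + B`** (memo NOTES-t1 D7(b)): `fibreSup r' ≤ fibreSup r + width_C(w)` for every
fibre `r'`, `width_C = topVal - botVal`. [folklore] -/
theorem fibre_near_top (h : Wins w a b c r z) (r' : G) :
    fibreSup w a b r' ≤ fibreSup w a b r + (topVal w c - botVal w c) := by
  have h1 := h r'
  linarith [le_topVal w c z, botVal_le w c (r + z - r')]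

end Wins

/-- **Full multiplicity in the geometric vocabulary** (memo L5 via `le_of_wins_all`): if the fibre `r₀` wins at EVERY position
(equivalently in every class), it is a top fibre: `fibreSup r ≤ fibreSup r₀` for all `r`. [folklore] -/
theorem fibreSup_le_of_wins_all (w : Fin 2 → ℝ) (a b c : G → (Fin 2 → ℝ)) (r₀ : G) (h : ∀ z, Wins w a b c r₀ z) (r : G) :
    fibreSup w a b r ≤ fibreSup w a b r₀ := by
  refine le_of_wins_all (fun r => fibreSup w a b r) (fun z => w ⬝ᵥ c z) r₀ (fun s r' => ?_) r
  have h1 := h (s - r₀) r'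
  have hs : r₀ + (s - r₀) - r' = s - r' := by abel
  rwa [hs] at h1

end TotalsLaw

end Summit.ValiantsHypothesis.ValiantsHypothesis.Theorems.NewtonUnitEquationsDissociatedUniform
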